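import Literature.AnabelianGeometry.SemiGraphs.TwistedCoveringChain
import Literature.AnabelianGeometry.SemiGraphs.GraphOfAnabelioidsGalois
import Literature.AnabelianGeometry.SemiGraphs.CoverticialVertexCaseTools
import Literature.AnabelianGeometry.SemiGraphs.Coverticial
import Literature.AnabelianGeometry.SemiGraphs.TreeSystemFixedClosedEdges
import HarnessLib

/-!
# [SemiAnbd] Proposition 2.6 — the sub-coverticial edge: descent along a finite étale covering

Mochizuki, *Semi-graphs of anabelioids*, Publ. RIMS **42** (2006), Proposition 2.6, author's
manuscript pp. 28–29 [cite: MochizukiSemiAnbd2006, Prop. 2.6 pp.28-29].  For an edge `e ∈ ℍ ∖ 𝕂`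
which is sub-coverticial — there is a finite étale covering `φ : 𝒢' → 𝒢` attached to `A ∈ B(𝒢)`
(LOCAL description `Hom.IsFiniteEtaleCoveringOf`, abc-iut-L3-t1) whose semi-graph contains distinct
coverticial edges `e₁ ≠ e₂` over `e` — the subgroup `Π_ℍ ∩ g Π_𝕂 g⁻¹` has infinite index in `Π_ℍ`
(`relIndex_conj_piK_piH_eq_zero_of_isFiniteEtaleCoveringOf`).  The print replaces `𝒢` by the
covering and counts sheets of cyclic coverings over the coverticial pair (abc-iut-L3-d1,
`CoverticialEdgeCasePair.lean`); here the cyclic covering is pushed forward to `𝒢` by hand as the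
`ℤ/M`-twist of `A` along the component `e₁` of `A_e` (`TwistedCovering.lean`), so that only the local
description of `φ` is used (no global clause, no alignment): `Π_𝕂` has orbits of `≤ deg A` points on
the fibre of `Z_M` while `Π_ℍ` has an orbit of `≥ M` points (`TwistedCoveringChain.lean`), whence
`[Π_ℍ : Π_ℍ ∩ g Π_𝕂 g⁻¹] · deg A ≥ M` for every `M` (`relIndex_eq_zero_of_twinComponents`).
The extraction of the twin-component configuration from the local description is the bookkeeping
of abc-iut-L6-d5 / abc-iut-L6-t17 (`range_cE_subset_of_branchClause`).  Proof-only
(abc-iut-L6-t18, sub-node P26-R); with `CoverticialAssembly.proposition_2_6_of_edgeCase` this closes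
`proposition_2_6` (`CoverticialHolds.lean`).  Nothing here takes a side on [IUTchIII] Cor. 3.12.
-/

namespace Literature.AnabelianGeometry.SemiGraphs

open CategoryTheory CategoryTheory.Limits CategoryTheory.PreGaloisCategory
open Literature.AnabelianGeometry.Anabelioids
open scoped Pointwise

universe v₁ u₁ u

namespace SemiGraphOfAnabelioids

open MulAction

variable (𝒢 : SemiGraphOfAnabelioids.{v₁, u₁, u}) (H : 𝒢.graph.Subgraph)

/-- **Transport through `B(𝒢_ℍ)`**, from the basepoint through `v₀ ∈ ℍ` to the basepoint through
`w ∈ ℍ`: a map `Π_ℍ^{(v₀)} → Π_𝒢^{(w)}` with values in `Π_ℍ ⊆ Π_𝒢`, and for any `Z ∈ B(𝒢)` a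
bijection of fibres `F₀(Z_{v₀}) ≃ F(Z_w)` intertwining it (isomorphism of basepoints of the Galois
category `B(𝒢_ℍ)`). [cite: MochizukiSemiAnbd2006, Prop. 2.6 p.29] -/
theorem exists_transport_piH' (hH : H.toSemiGraph.IsConnected) (v₀ : 𝒢.graph.Vertex)
    (hv₀ : v₀ ∈ H.verts) (F₀ : 𝒢.V v₀ ⥤ FintypeCat.{v₁}) [FiberFunctor F₀]
    (w : H.toSemiGraph.Vertex) (F : 𝒢.V w.1 ⥤ FintypeCat.{v₁}) [FiberFunctor F] (Z : 𝒢.BObj) :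
    ∃ (ι : (𝒢.restrict H).Pi ⟨v₀, hv₀⟩ F₀ → 𝒢.Pi w.1 F)
      (bij : F₀.obj (Z.S v₀) ≃ (𝒢.ρ w.1 ⋙ F).obj Z),
      (∀ σ, ι σ ∈ (𝒢.piHToPi H w F).range) ∧
        ∀ σ t, ι σ • bij t = bij (σ.hom.app ((𝒢.restrictFunctor H).obj Z) t) := by
  letI := (𝒢.restrict H).preGaloisCategory_bObj
  haveI : GaloisCategory (𝒢.restrict H).BObj := (𝒢.restrict H).galoisCategory_bObj ⟨hH⟩
  haveI : @FiberFunctor ((𝒢.restrict H).V ⟨v₀, hv₀⟩) ((𝒢.restrict H).catV ⟨v₀, hv₀⟩)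
      ((𝒢.restrict H).galV ⟨v₀, hv₀⟩).toPreGaloisCategory F₀ := ‹FiberFunctor F₀›
  haveI : @FiberFunctor ((𝒢.restrict H).V w) ((𝒢.restrict H).catV w)
      ((𝒢.restrict H).galV w).toPreGaloisCategory F := ‹FiberFunctor F›
  haveI : FiberFunctor ((𝒢.restrict H).ρ ⟨v₀, hv₀⟩ ⋙ F₀) :=
    (𝒢.restrict H).fiberFunctor_ρ ⟨hH⟩ ⟨v₀, hv₀⟩ F₀
  haveI : FiberFunctor ((𝒢.restrict H).ρ w ⋙ F) := (𝒢.restrict H).fiberFunctor_ρ ⟨hH⟩ w F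
  obtain ⟨β⟩ := nonempty_iso_of_fiberFunctor' ((𝒢.restrict H).ρ ⟨v₀, hv₀⟩ ⋙ F₀)
    ((𝒢.restrict H).ρ w ⋙ F)
  refine ⟨fun σ => 𝒢.piHToPi H w F (β.conjAut σ),
    Equiv.ofBijective (β.hom.app ((𝒢.restrictFunctor H).obj Z))
      (bijective_hom_app β ((𝒢.restrictFunctor H).obj Z)),
    fun σ => ⟨_, rfl⟩, fun σ t => ?_⟩
  exact conjAut_smul_app β σ ((𝒢.restrictFunctor H).obj Z) t

/-- **The core of the edge descent** ([SemiAnbd] Prop. 2.6, p. 29, sub-coverticial case): given the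
twin-component configuration over a closed edge `e = e(b₀) ∈ ℍ ∖ 𝕂` (components `T₁ ≠ T₂` of `T_e`
glued into components `S₀ ⊆ S_{v₀}`, `S₁ ⊆ S_{v₁}` at the two branches — the shadow of a coverticial
pair over `e` in a finite étale covering), `Π_ℍ ∩ g Π_𝕂 g⁻¹` has infinite index in `Π_ℍ`: the twisted
objects `Z_M` have `Π_𝕂`-orbits of bounded size and a `Π_ℍ`-orbit with `≥ M` points.
[cite: MochizukiSemiAnbd2006, Prop. 2.6 p.29] -/
theorem relIndex_eq_zero_of_twinComponents (hH : H.toSemiGraph.IsConnected) (K : 𝒢.graph.Subgraph)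
    (A : 𝒢.BObj) (b₀ : 𝒢.graph.Branch)
    (T₁ T₂ : π₀Obj (A.T (𝒢.graph.edgeOf b₀))) (hT : T₁ ≠ T₂)
    (v₀ v₁ : 𝒢.graph.Vertex) (h₀ : 𝒢.graph.abuts b₀ = some v₀)
    (b₁ : 𝒢.graph.Branch) (hb₁ : 𝒢.graph.edgeOf b₁ = 𝒢.graph.edgeOf b₀) (hne : b₁ ≠ b₀)
    (h₁ : 𝒢.graph.abuts b₁ = some v₁)
    (x y : 𝒢.graph.Branch) (hx : 𝒢.graph.edgeOf x = 𝒢.graph.edgeOf b₀)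
    (hy : 𝒢.graph.edgeOf y = 𝒢.graph.edgeOf b₀)
    (hxv : 𝒢.graph.abuts x = some v₁) (hyv : 𝒢.graph.abuts y = some v₀)
    (S₀ : π₀Obj (A.S v₀)) (S₁ : π₀Obj (A.S v₁))
    (g₀ : ∀ (Fe : 𝒢.E (𝒢.graph.edgeOf b₀) ⥤ FintypeCat.{v₁}) [FiberFunctor Fe],
      Set.range (Fe.map T₁.1.arrow) ⊆
        Set.range (Fe.map ((𝒢.pull b₀ v₀ h₀).pullback.map S₀.1.arrow ≫ (A.ψ b₀ v₀ h₀).hom)))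
    (g₁ : ∀ (Fe : 𝒢.E (𝒢.graph.edgeOf b₁) ⥤ FintypeCat.{v₁}) [FiberFunctor Fe],
      Set.range (Fe.map (hb₁ ▸ T₁ : π₀Obj (A.T (𝒢.graph.edgeOf b₁))).1.arrow) ⊆
        Set.range (Fe.map ((𝒢.pull b₁ v₁ h₁).pullback.map S₁.1.arrow ≫ (A.ψ b₁ v₁ h₁).hom)))
    (g₂ : ∀ (Fe : 𝒢.E (𝒢.graph.edgeOf x) ⥤ FintypeCat.{v₁}) [FiberFunctor Fe],
      Set.range (Fe.map (hx ▸ T₂ : π₀Obj (A.T (𝒢.graph.edgeOf x))).1.arrow) ⊆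
        Set.range (Fe.map ((𝒢.pull x v₁ hxv).pullback.map S₁.1.arrow ≫ (A.ψ x v₁ hxv).hom)))
    (g₃ : ∀ (Fe : 𝒢.E (𝒢.graph.edgeOf y) ⥤ FintypeCat.{v₁}) [FiberFunctor Fe],
      Set.range (Fe.map (hy ▸ T₂ : π₀Obj (A.T (𝒢.graph.edgeOf y))).1.arrow) ⊆
        Set.range (Fe.map ((𝒢.pull y v₀ hyv).pullback.map S₀.1.arrow ≫ (A.ψ y v₀ hyv).hom)))
    (hv₀ : v₀ ∈ H.verts) (hv₁ : v₁ ∈ H.verts) (he : 𝒢.graph.edgeOf b₀ ∈ H.edges)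
    (heK : 𝒢.graph.edgeOf b₀ ∉ K.edges)
    (w : H.toSemiGraph.Vertex) (F : 𝒢.V w.1 ⥤ FintypeCat.{v₁}) [FiberFunctor F]
    (w' : K.toSemiGraph.Vertex) (F' : 𝒢.V w'.1 ⥤ FintypeCat.{v₁}) [FiberFunctor F']
    (α : 𝒢.ρ w'.1 ⋙ F' ≅ 𝒢.ρ w.1 ⋙ F) (g : 𝒢.Pi w.1 F) :
    (ConjAct.toConjAct g •
        ((Aut.autMulEquivOfIso α).toMonoidHom.comp (𝒢.piHToPi K w' F')).range).relIndex
      (𝒢.piHToPi H w F).range = 0 := by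
  classical
  by_contra hn
  -- `M := [Π_ℍ : Π_ℍ ∩ Π_𝕂^g] · deg_{w'} A + 1`, the twisted object `Z_M`, its fibre `X` at `w`
  set n := (ConjAct.toConjAct g •
    ((Aut.autMulEquivOfIso α).toMonoidHom.comp (𝒢.piHToPi K w' F')).range).relIndex
      (𝒢.piHToPi H w F).range with hndef
  set d := Nat.card (F'.obj (A.S w'.1)) with hddef
  obtain ⟨M, hM⟩ : ∃ M, M = n * d + 1 := ⟨_, rfl⟩
  haveI : NeZero M := ⟨by omega⟩
  let Z : 𝒢.BObj := 𝒢.twistedObj A b₀ T₁.1.arrow M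
  -- 𝕂-side: every `Π_𝕂^g`-orbit on `F(Z_w)` has at most `d` points
  have hK : ∀ x : (𝒢.ρ w.1 ⋙ F).obj Z, Nat.card (orbit (↥(ConjAct.toConjAct g •
      ((Aut.autMulEquivOfIso α).toMonoidHom.comp (𝒢.piHToPi K w' F')).range)) x) ≤ d :=
    fun x => TwistedCovering.card_orbit_conj_le α (𝒢.piHToPi K w' F') Z d
      (fun x' => 𝒢.card_orbit_piK_twistedObj_le A b₀ T₁.1.arrow M K heK w' F' x') g x
  -- ℍ-side: `M` distinct points of `F(Z_w)` in one `Π_ℍ`-orbit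
  let F₀ := GaloisCategory.getFiberFunctor (𝒢.V v₀)
  obtain ⟨a₀, hlev⟩ := 𝒢.twistedObj_levels_mem_orbit A b₀ T₁ M H hH T₂ hT v₀ v₁ h₀ b₁ hb₁ hne h₁
    x y hx hy hxv hyv S₀ S₁ g₀ g₁ g₂ g₃ hv₀ hv₁ he F₀
  obtain ⟨ι, bij, hιH, hιeq⟩ := 𝒢.exists_transport_piH' H hH v₀ hv₀ F₀ w F Z
  let x₀ : (𝒢.ρ w.1 ⋙ F).obj Z := bij (F₀.map (Sigma.ι (fun _ : ZMod M => A.S v₀) 0) a₀)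
  have hmem : ∀ i : ZMod M, bij (F₀.map (Sigma.ι (fun _ : ZMod M => A.S v₀) i) a₀) ∈
      orbit (𝒢.piHToPi H w F).range x₀ := by
    intro i
    obtain ⟨σ, hσ⟩ := hlev i
    refine ⟨⟨ι σ, hιH σ⟩, ?_⟩
    change ι σ • x₀ = _
    rw [hιeq, hσ]
  have hinj : Function.Injective (fun i : ZMod M =>
      (⟨bij (F₀.map (Sigma.ι (fun _ : ZMod M => A.S v₀) i) a₀), hmem i⟩ :
        orbit (𝒢.piHToPi H w F).range x₀)) := by
    intro i j hij
    have h1 := bij.injective (congrArg Subtype.val hij)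
    exact TwistedCovering.level_eq_of_map_ι_eq F₀ (A.S v₀) h1
  have hH' : M ≤ Nat.card (orbit (𝒢.piHToPi H w F).range x₀) := by
    have := Nat.card_le_card_of_injective _ hinj
    rwa [Nat.card_eq_fintype_card, ZMod.card] at this
  -- count
  have hcount := TwistedCovering.card_orbit_le_relIndex_mul (𝒢.piHToPi H w F).range
    (ConjAct.toConjAct g •
      ((Aut.autMulEquivOfIso α).toMonoidHom.comp (𝒢.piHToPi K w' F')).range) x₀ hn
  have := (hH'.trans hcount).trans (Nat.mul_le_mul_left _ (hK x₀))
  rw [← hndef] at this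
  omega

end SemiGraphOfAnabelioids

end Literature.AnabelianGeometry.SemiGraphs

namespace Literature.AnabelianGeometry.SemiGraphs

open CategoryTheory CategoryTheory.Limits CategoryTheory.PreGaloisCategory
open Literature.AnabelianGeometry.Anabelioids
open scoped Pointwise

universe v₁ u₁ u

namespace SemiGraphOfAnabelioids

variable {𝒢 𝒢' : SemiGraphOfAnabelioids.{v₁, u₁, u}}

/-! ### Reading the local description of a finite étale covering (transport bookkeeping) -/

/-- `⟨e₁, h ▸ Q⟩ = ⟨e₂, Q⟩` in the Σ-type of edge components (abc-iut-L6-d5's bookkeeping lemma).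
[cite: MochizukiSemiAnbd2006, Def. 2.2(i) p.23] -/
theorem sigma_mk_cast_T (A : 𝒢.BObj) {e₁ e₂ : 𝒢.graph.Edge} (h : e₁ = e₂) (Q : π₀Obj (A.T e₂)) :
    (⟨e₁, (h ▸ Q : π₀Obj (A.T e₁))⟩ : Σ e, π₀Obj (A.T e)) = ⟨e₂, Q⟩ := by
  subst h
  rfl

/-- Components over the same edge with the same point of `Σ e, π₀(T_e)` are equal.
[cite: MochizukiSemiAnbd2006, Def. 2.2(i) p.23] -/
theorem eq_of_sigma_mk_eq_T (A : 𝒢.BObj) {e : 𝒢.graph.Edge} (R₁ R₂ : π₀Obj (A.T e))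
    (h : (⟨e, R₁⟩ : Σ e, π₀Obj (A.T e)) = ⟨e, R₂⟩) : R₁ = R₂ :=
  eq_of_heq (Sigma.mk.inj_iff.mp h).2

/-- Two transports of edge components to a common edge agree if they agree in `Σ e, π₀(T_e)`.
[cite: MochizukiSemiAnbd2006, Def. 2.2(i) p.23] -/
theorem cast_eq_cast_of_sigma_eq_T (A : 𝒢.BObj) {e e₁ e₂ : 𝒢.graph.Edge} (h₁ : e = e₁) (h₂ : e = e₂)
    (Q₁ : π₀Obj (A.T e₁)) (Q₂ : π₀Obj (A.T e₂))
    (h : (⟨e₁, Q₁⟩ : Σ e, π₀Obj (A.T e)) = ⟨e₂, Q₂⟩) :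
    (h₁ ▸ Q₁ : π₀Obj (A.T e)) = (h₂ ▸ Q₂ : π₀Obj (A.T e)) := by
  subst h₁
  obtain ⟨rfl, hq⟩ := Sigma.mk.inj_iff.mp h
  cases hq
  rfl

/-- Composite transports of edge components. [cite: MochizukiSemiAnbd2006, Def. 2.2(i) p.23] -/
theorem cast_cast_T (A : 𝒢.BObj) {e e' e'' : 𝒢.graph.Edge} (h : e' = e) (h' : e = e'')
    (Q : π₀Obj (A.T e'')) :
    (h ▸ (h' ▸ Q : π₀Obj (A.T e)) : π₀Obj (A.T e')) = ((h.trans h') ▸ Q : π₀Obj (A.T e')) := by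
  subst h'
  subst h
  rfl

/-- The branch clause of `IsFiniteEtaleCoveringOf`, read at the home edge as an inclusion of
fibre-images (after abc-iut-L6-d5). [cite: MochizukiSemiAnbd2006, Def. 2.2(i) p.23] -/
theorem range_subset_of_branchClause (A : 𝒢.BObj) {e₁ e₂ : 𝒢.graph.Edge} (h : e₁ = e₂)
    (F : 𝒢.E e₁ ⥤ FintypeCat.{v₁}) {X : 𝒢.E e₁} (g : X ⟶ A.T e₁) (Q : π₀Obj (A.T e₂))
    (f : (Q.1 : 𝒢.E e₂) ⟶ (𝒢.transportE h).obj X)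
    (hf : f ≫ (𝒢.transportE h).map g ≫ eqToHom (𝒢.transportE_obj_T A h) = Q.1.arrow) :
    Set.range (F.map (h ▸ Q : π₀Obj (A.T e₁)).1.arrow) ⊆ Set.range (F.map g) := by
  subst h
  change f ≫ g ≫ eqToHom rfl = Q.1.arrow at hf
  rw [eqToHom_refl, Category.comp_id] at hf
  change Set.range (F.map Q.1.arrow) ⊆ _
  rintro x ⟨q, rfl⟩
  refine ⟨F.map f q, ?_⟩
  have := congrArg (fun k => F.map k q) hf
  simp only [F.map_comp, FintypeCat.comp_apply] at this
  exact this

/-- The branch clause at a branch `b'` of `𝒢'` PRESENTED over `b = φ b'`: the component `cE(e(b'))`,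
transported to `T_{e(b)}`, has fibre-image inside that of `b^*(cV w) ↪ b^* S_v ⥲ T_{e(b)}`.
[cite: MochizukiSemiAnbd2006, Def. 2.2(i) p.23] -/
theorem range_cE_subset_of_branchClause (φ : Hom 𝒢' 𝒢) (A : 𝒢.BObj)
    (cV : ∀ v' : 𝒢'.graph.Vertex, π₀Obj (A.S (φ.base.vertexMap v')))
    (cE : ∀ e' : 𝒢'.graph.Edge, π₀Obj (A.T (φ.base.edgeMap e')))
    (hbr : ∀ (b' : 𝒢'.graph.Branch) (v' : 𝒢'.graph.Vertex) (h' : 𝒢'.graph.abuts b' = some v'),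
      ∃ f : ((cE (𝒢'.graph.edgeOf b')).1 : 𝒢.E (φ.base.edgeMap (𝒢'.graph.edgeOf b'))) ⟶
          (𝒢.transportE (φ.base.edgeOf_branchMap b')).obj
            ((𝒢.pull (φ.base.branchMap b') (φ.base.vertexMap v')
              (φ.base.abuts_branchMap b' v' h')).pullback.obj ((cV v').1 : 𝒢.V (φ.base.vertexMap v'))),
        f ≫ (𝒢.transportE (φ.base.edgeOf_branchMap b')).map
              ((𝒢.pull _ _ (φ.base.abuts_branchMap b' v' h')).pullback.map (cV v').1.arrow ≫
                (A.ψ (φ.base.branchMap b') (φ.base.vertexMap v') (φ.base.abuts_branchMap b' v' h')).hom) ≫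
            eqToHom (𝒢.transportE_obj_T A (φ.base.edgeOf_branchMap b')) =
          (cE (𝒢'.graph.edgeOf b')).1.arrow)
    (b' : 𝒢'.graph.Branch) (v' : 𝒢'.graph.Vertex) (hv' : 𝒢'.graph.abuts b' = some v')
    (Fe : 𝒢.E (𝒢.graph.edgeOf (φ.base.branchMap b')) ⥤ FintypeCat.{v₁}) :
    Set.range (Fe.map (φ.base.edgeOf_branchMap b' ▸ cE (𝒢'.graph.edgeOf b') :
        π₀Obj (A.T (𝒢.graph.edgeOf (φ.base.branchMap b')))).1.arrow) ⊆
      Set.range (Fe.map ((𝒢.pull (φ.base.branchMap b') _ (φ.base.abuts_branchMap b' v' hv')).pullback.map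
        (cV v').1.arrow ≫ (A.ψ (φ.base.branchMap b') _ (φ.base.abuts_branchMap b' v' hv')).hom)) := by
  obtain ⟨f, hf⟩ := hbr b' v' hv'
  exact range_subset_of_branchClause A (φ.base.edgeOf_branchMap b') Fe _ (cE _) f hf

variable (𝒢)

/-- **[SemiAnbd] Proposition 2.6, the case of a sub-coverticial edge — descent along the LOCAL
description of a finite étale covering** (p. 29: "it suffices [by replacing `𝒢` by a finite étale
covering] … under the assumption that `ℍ` contains a pair of distinct coverticial edges"): if
`φ : 𝒢' → 𝒢` is the finite étale covering attached to `A ∈ B(𝒢)` (local description) and the distinct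
coverticial edges `e₁ ≠ e₂` of `𝔾'` both lie over `e ∈ ℍ ∖ 𝕂` (`ℍ` a connected graph), then
`Π_ℍ ∩ g Π_𝕂 g⁻¹` has infinite index in `Π_ℍ` for every `g ∈ Π_𝒢` — with the binders of
abc-iut-L3-t1's `proposition_2_6`. The print's "replacing `𝒢` by a finite étale covering" is realised
DOWNSTAIRS: the cyclic covering over the coverticial pair, pushed forward to `𝒢`, is the `ℤ/M`-twist
of `A` along the component `e₁` of `A_e` (`twistedObj`). [cite: MochizukiSemiAnbd2006, Prop. 2.6 p.29] -/
theorem relIndex_conj_piK_piH_eq_zero_of_isFiniteEtaleCoveringOf (φ : Hom 𝒢' 𝒢) (A : 𝒢.BObj)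
    (hloc : φ.IsFiniteEtaleCoveringOf A) {e₁ e₂ : 𝒢'.graph.Edge} (hne : e₁ ≠ e₂)
    (hcov : 𝒢'.graph.Coverticial e₁ e₂) {e : 𝒢.graph.Edge} (he₁ : φ.base.edgeMap e₁ = e)
    (he₂ : φ.base.edgeMap e₂ = e) (H K : 𝒢.graph.Subgraph) (hH : H.toSemiGraph.IsConnected)
    (hHg : H.toSemiGraph.IsGraph) (heH : e ∈ H.edges) (heK : e ∉ K.edges)
    (w : H.toSemiGraph.Vertex) (F : 𝒢.V w.1 ⥤ FintypeCat.{v₁}) [FiberFunctor F]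
    (w' : K.toSemiGraph.Vertex) (F' : 𝒢.V w'.1 ⥤ FintypeCat.{v₁}) [FiberFunctor F']
    (α : 𝒢.ρ w'.1 ⋙ F' ≅ 𝒢.ρ w.1 ⋙ F) (g : 𝒢.Pi w.1 F) :
    (ConjAct.toConjAct g •
        ((Aut.autMulEquivOfIso α).toMonoidHom.comp (𝒢.piHToPi K w' F')).range).relIndex
      (𝒢.piHToPi H w F).range = 0 := by
  classical
  obtain ⟨-, cV, cE, -, hbijE, -, -, hbr⟩ := hloc
  -- the branches `c₀ ≠ c₁` of `e₁` (closed), abutting to `v₀', v₁'`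
  obtain ⟨c₀, c₁, v₀', v₁', hcc, hc₀, hc₁, hc₀v, hc₁v⟩ := SemiGraph.exists_branches_of_isClosedEdge hcov.1
  subst hc₀
  subst he₁
  -- branches `dx`, `dy` of `e₂` abutting to `v₁'`, `v₀'` (coverticiality)
  obtain ⟨dx, hdx, hdxv⟩ := (hcov.2.2 v₁').mp ⟨c₁, hc₁, hc₁v⟩
  obtain ⟨dy, hdy, hdyv⟩ := (hcov.2.2 v₀').mp ⟨_, rfl, hc₀v⟩
  -- the data downstairs
  have h₀ := φ.base.abuts_branchMap c₀ v₀' hc₀v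
  have h₁ := φ.base.abuts_branchMap c₁ v₁' hc₁v
  have hxv := φ.base.abuts_branchMap dx v₁' hdxv
  have hyv := φ.base.abuts_branchMap dy v₀' hdyv
  have hE₀ : 𝒢.graph.edgeOf (φ.base.branchMap c₀) = φ.base.edgeMap (𝒢'.graph.edgeOf c₀) :=
    φ.base.edgeOf_branchMap c₀
  have hb₁ : 𝒢.graph.edgeOf (φ.base.branchMap c₁) = 𝒢.graph.edgeOf (φ.base.branchMap c₀) := by
    rw [φ.base.edgeOf_branchMap, φ.base.edgeOf_branchMap, hc₁]
  have hx : 𝒢.graph.edgeOf (φ.base.branchMap dx) = 𝒢.graph.edgeOf (φ.base.branchMap c₀) := by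
    rw [φ.base.edgeOf_branchMap, φ.base.edgeOf_branchMap, hdx, he₂]
  have hy : 𝒢.graph.edgeOf (φ.base.branchMap dy) = 𝒢.graph.edgeOf (φ.base.branchMap c₀) := by
    rw [φ.base.edgeOf_branchMap, φ.base.edgeOf_branchMap, hdy, he₂]
  have hneb : φ.base.branchMap c₁ ≠ φ.base.branchMap c₀ := fun h =>
    hcc (φ.base.branchMap_injOn c₀ c₁ hc₁.symm h.symm)
  have hE₂ : 𝒢.graph.edgeOf (φ.base.branchMap c₀) = φ.base.edgeMap e₂ := by rw [hE₀, he₂]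
  -- memberships
  have he : 𝒢.graph.edgeOf (φ.base.branchMap c₀) ∈ H.edges := by rwa [hE₀]
  have heK' : 𝒢.graph.edgeOf (φ.base.branchMap c₀) ∉ K.edges := by rwa [hE₀]
  have hv₀ : φ.base.vertexMap v₀' ∈ H.verts := by
    obtain ⟨u, hu⟩ := Option.isSome_iff_exists.mp (hHg.abuts_isSome ⟨φ.base.branchMap c₀, he⟩)
    have := (SemiGraph.Subgraph.abuts_eq_some_iff H _ _).mp hu
    rw [h₀] at this
    rw [Option.some.inj this]
    exact u.2
  have hv₁ : φ.base.vertexMap v₁' ∈ H.verts := by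
    obtain ⟨u, hu⟩ := Option.isSome_iff_exists.mp
      (hHg.abuts_isSome ⟨φ.base.branchMap c₁, hb₁ ▸ he⟩)
    have := (SemiGraph.Subgraph.abuts_eq_some_iff H _ _).mp hu
    rw [h₁] at this
    rw [Option.some.inj this]
    exact u.2
  -- the gluing clauses at the four branches
  have g₀ := fun (Fe : 𝒢.E (𝒢.graph.edgeOf (φ.base.branchMap c₀)) ⥤ FintypeCat.{v₁})
    [FiberFunctor Fe] => range_cE_subset_of_branchClause φ A cV cE hbr c₀ v₀' hc₀v Fe
  have g₁ := fun (Fe : 𝒢.E (𝒢.graph.edgeOf (φ.base.branchMap c₁)) ⥤ FintypeCat.{v₁})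
    [FiberFunctor Fe] => range_cE_subset_of_branchClause φ A cV cE hbr c₁ v₁' hc₁v Fe
  have g₂ := fun (Fe : 𝒢.E (𝒢.graph.edgeOf (φ.base.branchMap dx)) ⥤ FintypeCat.{v₁})
    [FiberFunctor Fe] => range_cE_subset_of_branchClause φ A cV cE hbr dx v₁' hdxv Fe
  have g₃ := fun (Fe : 𝒢.E (𝒢.graph.edgeOf (φ.base.branchMap dy)) ⥤ FintypeCat.{v₁})
    [FiberFunctor Fe] => range_cE_subset_of_branchClause φ A cV cE hbr dy v₀' hdyv Fe
  -- the components, transported to the home edge `e(φ c₀)`, and their identifications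
  have hT : (φ.base.edgeOf_branchMap c₀ ▸ cE (𝒢'.graph.edgeOf c₀) :
      π₀Obj (A.T (𝒢.graph.edgeOf (φ.base.branchMap c₀)))) ≠ hE₂ ▸ cE e₂ := by
    intro h
    have h3 : (⟨φ.base.edgeMap (𝒢'.graph.edgeOf c₀), cE (𝒢'.graph.edgeOf c₀)⟩ :
        Σ e, π₀Obj (A.T e)) = ⟨φ.base.edgeMap e₂, cE e₂⟩ := by
      rw [← sigma_mk_cast_T A (φ.base.edgeOf_branchMap c₀) (cE (𝒢'.graph.edgeOf c₀)),
        ← sigma_mk_cast_T A hE₂ (cE e₂)]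
      exact congrArg _ h
    exact hne (hbijE.1 h3)
  have hT₁ : (φ.base.edgeOf_branchMap c₁ ▸ cE (𝒢'.graph.edgeOf c₁) :
      π₀Obj (A.T (𝒢.graph.edgeOf (φ.base.branchMap c₁)))) =
      (hb₁ ▸ (φ.base.edgeOf_branchMap c₀ ▸ cE (𝒢'.graph.edgeOf c₀) :
        π₀Obj (A.T (𝒢.graph.edgeOf (φ.base.branchMap c₀)))) :
        π₀Obj (A.T (𝒢.graph.edgeOf (φ.base.branchMap c₁)))) := by
    rw [cast_cast_T A hb₁ (φ.base.edgeOf_branchMap c₀)]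
    exact cast_eq_cast_of_sigma_eq_T A (φ.base.edgeOf_branchMap c₁)
      (hb₁.trans (φ.base.edgeOf_branchMap c₀)) _ _
      (congrArg (fun e' => (⟨φ.base.edgeMap e', cE e'⟩ : Σ e, π₀Obj (A.T e))) hc₁)
  have hT₂x : (φ.base.edgeOf_branchMap dx ▸ cE (𝒢'.graph.edgeOf dx) :
      π₀Obj (A.T (𝒢.graph.edgeOf (φ.base.branchMap dx)))) =
      (hx ▸ (hE₂ ▸ cE e₂ : π₀Obj (A.T (𝒢.graph.edgeOf (φ.base.branchMap c₀)))) :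
        π₀Obj (A.T (𝒢.graph.edgeOf (φ.base.branchMap dx)))) := by
    rw [cast_cast_T A hx hE₂]
    exact cast_eq_cast_of_sigma_eq_T A (φ.base.edgeOf_branchMap dx) (hx.trans hE₂) _ _
      (congrArg (fun e' => (⟨φ.base.edgeMap e', cE e'⟩ : Σ e, π₀Obj (A.T e))) hdx)
  have hT₂y : (φ.base.edgeOf_branchMap dy ▸ cE (𝒢'.graph.edgeOf dy) :
      π₀Obj (A.T (𝒢.graph.edgeOf (φ.base.branchMap dy)))) =
      (hy ▸ (hE₂ ▸ cE e₂ : π₀Obj (A.T (𝒢.graph.edgeOf (φ.base.branchMap c₀)))) :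
        π₀Obj (A.T (𝒢.graph.edgeOf (φ.base.branchMap dy)))) := by
    rw [cast_cast_T A hy hE₂]
    exact cast_eq_cast_of_sigma_eq_T A (φ.base.edgeOf_branchMap dy) (hy.trans hE₂) _ _
      (congrArg (fun e' => (⟨φ.base.edgeMap e', cE e'⟩ : Σ e, π₀Obj (A.T e))) hdy)
  rw [hT₁] at g₁
  rw [hT₂x] at g₂
  rw [hT₂y] at g₃
  exact 𝒢.relIndex_eq_zero_of_twinComponents H hH K A (φ.base.branchMap c₀) _ _ hT
    (φ.base.vertexMap v₀') (φ.base.vertexMap v₁') h₀ (φ.base.branchMap c₁) hb₁ hneb h₁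
    (φ.base.branchMap dx) (φ.base.branchMap dy) hx hy hxv hyv (cV v₀') (cV v₁')
    g₀ g₁ g₂ g₃ hv₀ hv₁ he heK' w F w' F' α g

end SemiGraphOfAnabelioids

end Literature.AnabelianGeometry.SemiGraphs
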